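import Summits.BirchSwinnertonDyer.BirchSwinnertonDyer.Theorems.SchneiderFreeAdditiveX3AnticycControlAdditivePtSurjAnyTorsion
import Summits.BirchSwinnertonDyer.BirchSwinnertonDyer.Theorems.SchneiderFreeAdditiveX3AnticycControlAdditiveBaseCountFiniteAnyTorsion
import Summits.BirchSwinnertonDyer.BirchSwinnertonDyer.Theorems.SchneiderFreeAdditiveX3AnticycControlAdditiveH2AnyTorsion
import Summits.BirchSwinnertonDyer.Rank1Residual.X11b.AnticyclotomicCoinvariants
import Literature.NumberTheory.GaloisRepresentations.NumberFieldCdTwoProofs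
import HarnessLib

/-!
# Crux `AnticycControlAdditiveK` (route `SchneiderFreeAdditiveX3`, item stmt-BirchSwinnertonDyer-19295),
# atom (L10) on regime B2 (`E(K)[p] ≠ 0`) — part 2: `CoinvariantsTrivialAt` at EVERY frame and the
# registered stub `stub_coinv` modulo the cited Poitou–Tate facts and the crux's Kolyvagin antecedent

Seat `bsd-schneider-door-c6` (cell `bsd-schneider-ideate`). Door-c4 gen 2's
`coinvariantsTrivialAt_of_subsingleton_noLocal` (= multr1-p1's `Coinv.coinvariantsTrivialAt_of_subsingleton`,
JSW17 Lemma 3.3.3 in route R1's `K_∞`-formulation, without Castella's (iv)) still carries the GLOBAL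
hypothesis `E(K̄)[p^∞]^{Γ_K} = 0` — through the Poitou–Tate surgery step only. With the seat's
`levelLiftingP_of_finite_anyTorsion` (part `…PtSurjLift` / `…PtSurjAnyTorsion`) that hypothesis becomes a
killing exponent of the finite group `E(K̄)[p^∞]^{D_𝔮}`; with `subsingleton_galoisCohomology_two_primary_anyTorsion`
(part `…H2AnyTorsion`) the input `H²(K, E[p^∞]) = 0` no longer needs it either; and with
`finite_selmerAcBase_of_rankOne_anyTorsion` (part `…BaseCountFiniteAnyTorsion`) the finiteness of
Castella's Selmer groups at both primes above `p` comes from rank one + `Ш` finite alone. Results: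

* `coinvariantsTrivialAt_of_subsingleton_anyTorsion` — (L10) from `H² = 0`, NO (iv), NO `E(K)[p] = 0`;
* `coinvariantsTrivialAt_of_finite_anyTorsion` — (L10) for `E/ℚ` over an imaginary quadratic `K` with `p`
  split, at EVERY frame, ⇐ the cited Poitou–Tate duality (Selmer structures; `Ш`) + finiteness of
  `Sel_v(K, E[p^∞])` at both `v ∣ p`;
* **`stub_coinv_of_poitouTate`** — the REGISTERED `stub_coinv` signature verbatim ⇐
  `(∀ K, poitouTate_selmerStructure_duality K)` + `(∀ K, poitouTate_sha_tateDual K)` +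
  `(∀ N W K, kolyvagin N W K)`, nothing else (regime B2 and `t_p ≥ 1` included).

`cd_p K ≤ 2` and Milne I 2.8 are tree theorems (`fieldCdLE_two_of_numberField_holds`,
`localEulerPoincareCharacteristic_adicCompletionEP`). CONDITIONAL on the cited facts (hypotheses BY NAME);
no `Prop` fact minted; closes nothing by itself; BSD is not proved by any of this. Like `stub_ptSurj`, the
registered `stub_coinv` carries no Kolyvagin prefix although JSW17 Lemma 3.3.3 consumes (corank 1)+(sur)
— see the seat's finding on the item.

References: [JetchevSkinnerWan2017] Lemma 3.3.3, Prop. 3.3.2 (arXiv:1512.06894 pp. 11–12);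
[Castella2018] Def. 2.2, Thm. 2.3 (arXiv:1704.06608 p. 5); [MilneADT2006] I Thm. 2.8, 4.10;
[Harari2020] Thm. 17.13 (b); [Gross1991] Thm. 1.3.
-/

noncomputable section

open scoped Classical

open CategoryTheory Field NumberField IsDedekindDomain
open Literature.NumberTheory.EllipticCurves Literature.NumberTheory.EllipticCurves.GreenbergSelmer
open Literature.NumberTheory.GaloisRepresentations
open Literature.NumberTheory.GaloisRepresentations.DiscreteGaloisModule (SelmerStructure TateDual
  tateDual localTatePairingZMod unramifiedSubgroup)
open Literature.NumberTheory.GaloisCohomology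
open scoped ContRepresentation

set_option linter.dupNamespace false

namespace Summit.BirchSwinnertonDyer.BirchSwinnertonDyer.Theorems.SchneiderFreeAdditiveX3

open Summit.BirchSwinnertonDyer.Rank1Residual.X11b
open Summit.BirchSwinnertonDyer.Rank1Residual.X11b.AcSelmer
open Summit.BirchSwinnertonDyer.Rank1Residual.X11b.LocBridge
open Summit.BirchSwinnertonDyer.Rank1Residual.X11b.Levels
open Summit.BirchSwinnertonDyer.Rank1Residual.X11b.Coinv
open Summit.BirchSwinnertonDyer.Rank1Residual.X11b.ProcyclicDescent (kerK)
open Summit.BirchSwinnertonDyer.Rank1Residual.X11b.H2Support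
open Function

/-! ## §1. (L10) from `H² = 0`, regime B2 included -/

section Coinvariants

variable {K : Type} [Field K] [NumberField K] (W : WeierstrassCurve K) [W.IsElliptic] (p : ℕ)
  [Fact p.Prime] (κ : ZpExtension K p)

/-- **(L10) `CoinvariantsTrivialAt` from `H²(K, E[p^∞]) = 0`, WITHOUT (iv) and WITHOUT `E(K)[p] = 0`**
— door-c4 gen 2's `coinvariantsTrivialAt_of_subsingleton_noLocal` (= multr1-p1's
`Coinv.coinvariantsTrivialAt_of_subsingleton`, JSW17 Lemma 3.3.3 in route R1's `K_∞`-formulation)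
VERBATIM with the Poitou–Tate surgery step `levelLiftingP_of_finite_anyTorsion`, so that the global
no-invariants hypothesis is replaced by a killing exponent of the finite group `E(K̄)[p^∞]^{D_𝔮}`
(credit: multr1-p1, door-c4). Hypotheses: `K` totally complex; the cited Poitou–Tate fact; `𝔭 ≠ 𝔮`
above `p`; `Sel_𝔮(K, E[p^∞])` finite; `H²(K, E[p^∞]) = 0`; `γ` a topological generator of `κ`; Milne
I 2.8 at the completions is the tree theorem `localEulerPoincareCharacteristic_adicCompletionEP`.
Conclusion: `conj_γ − 1` is onto `Sel_𝔭(K_∞, E[p^∞])`.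
[cite: JetchevSkinnerWan2017, Lemma 3.3.3 and Prop. 3.3.2 (arXiv:1512.06894 pp. 11–12)]
[cite: Castella2018, Thm. 2.3 (arXiv:1704.06608 p. 5)] -/
theorem coinvariantsTrivialAt_of_subsingleton_anyTorsion [IsTotallyComplex K]
    (hPT : poitouTate_selmerStructure_duality K)
    {𝔭 𝔮 : HeightOneSpectrum (𝓞 K)} (h𝔭 : ((p : ℕ) : 𝓞 K) ∈ 𝔭.asIdeal)
    (h𝔮 : ((p : ℕ) : 𝓞 K) ∈ 𝔮.asIdeal) (hne : 𝔮 ≠ 𝔭)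
    {m : ℕ} (htor𝔮 : ∀ Q : W.geomPrimaryTorsion p, (∀ d ∈ decomp 𝔮, d • Q = Q) → p ^ m • Q = 0)
    (hfin : Finite (selmerAcBase W p 𝔮 ∅))
    (h2 : Subsingleton (galoisCohomology (primaryGaloisModule W p) 2))
    {γ : absoluteGaloisGroup K} (hγ : κ.IsTopGenerator γ) :
    CoinvariantsTrivialAt W p κ 𝔭 γ := by
  intro x
  have hM : ∀ m : W.geomPrimaryTorsion p, IsOpen {σ : absoluteGaloisGroup K | σ • m = m} :=
    isOpen_stabilizer_geomPrimaryTorsion W p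
  -- (1) `y₀` with `conj_γ y₀ - y₀ = x`
  obtain ⟨y₀, hy₀⟩ :=
    exists_conjH1_sub_eq_of_subsingleton W p κ h2 hγ (x : W.subgroupH1 p κ.kerSubgroup)
  -- (2) all conjugates of `y₀` agree with `y₀` modulo `Sel`
  have hSel : ∀ g : absoluteGaloisGroup K,
      W.conjH1 p κ.kerSubgroup g y₀ - y₀ ∈ selmerAc W p κ 𝔭 ∅ :=
    conjH1_sub_mem_selmerAc_of_isTopGenerator hγ (by rw [hy₀]; exact x.2)
  -- the cocycle of `y₀` and its zero set
  obtain ⟨φ, hφ⟩ := oneCocycleClass_surjective _ y₀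
  obtain ⟨N₁, hN₁⟩ := exists_openNormalSubgroup_forall_apply_eq_zero (K := K) φ
  -- the exceptional set `Σ'` (finite, away from `p`)
  set S' : Set (HeightOneSpectrum (𝓞 K)) := {v | ((p : ℕ) : 𝓞 K) ∉ v.asIdeal ∧
    (¬ W.HasGoodReductionAt v ∨
      ¬ (adicCompletionPrime K v).inertia (absoluteGaloisGroup K) ≤ (N₁ : Subgroup _))} with hS'
  have hS'fin : S'.Finite := finite_exceptional W p N₁
  have hSp : ∀ v ∈ S', ((p : ℕ) : 𝓞 K) ∉ v.asIdeal := fun v hv ↦ hv.1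
  -- (3) the local lifts
  have hz : ∀ v : HeightOneSpectrum (𝓞 K), (((p : ℕ) : 𝓞 K) ∉ v.asIdeal ∨ v = 𝔭) →
      ∃ z : subgroupH1 (decomp (K := K) v) (W.geomPrimaryTorsion p),
        ResKernel.resSubgroup (kerD κ v) (W.geomPrimaryTorsion p) z =
          resKerD κ (W.geomPrimaryTorsion p) v y₀ := fun v hv ↦
    exists_resSubgroup_kerD_eq v (hv.imp (fun h ↦ ⟨h, Set.notMem_empty v⟩) id) hSel
  choose z hz using hz
  -- at the good unramified `v ∉ Σ'`, `v ∤ p`: `Ψ_v = 0` and `y₀` is locally trivial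
  have hzero : ∀ (v : HeightOneSpectrum (𝓞 K)) (hpv : ((p : ℕ) : 𝓞 K) ∉ v.asIdeal), v ∉ S' →
      resKerD κ (W.geomPrimaryTorsion p) v y₀ = 0 := by
    intro v hpv hvS
    have hgood : W.HasGoodReductionAt v := by
      by_contra h; exact hvS ⟨hpv, Or.inl h⟩
    have hI : (adicCompletionPrime K v).inertia (absoluteGaloisGroup K) ≤ (N₁ : Subgroup _) := by
      by_contra h; exact hvS ⟨hpv, Or.inr h⟩
    have h := hz v (Or.inl hpv)
    rw [← hφ] at h ⊢
    exact (eq_zero_of_inertia_le hpv hgood φ hN₁ hI (z v (Or.inl hpv)) h).2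
  -- the finite set `T` of places: `∞ ∪ {v ∣ p} ∪ Σ'`
  have hp0 : p ≠ 0 := (Fact.out : p.Prime).ne_zero
  set T : Finset (Place K) := (Finset.univ.image Sum.inl) ∪
    (((finite_setOf_natCast_mem (K := K) p hp0).toFinset ∪ hS'fin.toFinset).image Sum.inr) with hT
  have hinf : ∀ w : InfinitePlace K, (Sum.inl w : Place K) ∈ T := fun w ↦
    Finset.mem_union_left _ (Finset.mem_image_of_mem _ (Finset.mem_univ w))
  have hpT : ∀ v : HeightOneSpectrum (𝓞 K), ((p : ℕ) : 𝓞 K) ∈ v.asIdeal →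
      (Sum.inr v : Place K) ∈ T := fun v hv ↦
    Finset.mem_union_right _ (Finset.mem_image_of_mem _
      (Finset.mem_union_left _ ((Set.Finite.mem_toFinset _).mpr hv)))
  have hSig : ∀ v ∈ S', (Sum.inr v : Place K) ∈ T := fun v hv ↦
    Finset.mem_union_right _ (Finset.mem_image_of_mem _
      (Finset.mem_union_right _ ((Set.Finite.mem_toFinset _).mpr hv)))
  have hbad : ∀ v : HeightOneSpectrum (𝓞 K), ¬ W.HasGoodReductionAt v →
      (Sum.inr v : Place K) ∈ T := by
    intro v hv
    by_cases hpv : ((p : ℕ) : 𝓞 K) ∈ v.asIdeal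
    · exact hpT v hpv
    · exact hSig v ⟨hpv, Or.inl hv⟩
  have hRfin : {v : HeightOneSpectrum (𝓞 K) | (Sum.inr v : Place K) ∈ T ∧
      ((p : ℕ) : 𝓞 K) ∉ v.asIdeal}.Finite :=
    (T.finite_toSet.preimage Sum.inr_injective.injOn).subset fun v hv ↦ hv.1
  have hfinR := finite_relaxed W p (𝔮 := 𝔮)
    (fun v ↦ localEulerPoincareCharacteristic_adicCompletionEP K v) hfin hRfin (fun v hv ↦ hv.2)
  -- the family of local classes on `Σ'⁺ = Σ' ∪ {𝔭}` and a common killing exponent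
  have hmem : ∀ v : (insert 𝔭 S' : Set (HeightOneSpectrum (𝓞 K))),
      ((p : ℕ) : 𝓞 K) ∉ (v : HeightOneSpectrum (𝓞 K)).asIdeal ∨
        (v : HeightOneSpectrum (𝓞 K)) = 𝔭 :=
    fun v ↦ (Set.mem_insert_iff.mp v.2).elim Or.inr fun h ↦ Or.inl h.1
  let τ : ∀ v : (insert 𝔭 S' : Set (HeightOneSpectrum (𝓞 K))),
      galoisCohomology
        ((primaryGaloisModule W p).toLocal (Sum.inr (v : HeightOneSpectrum (𝓞 K)))) 1 :=
    fun v ↦ inflDecomp hM (v : HeightOneSpectrum (𝓞 K)) (z v (hmem v))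
  obtain ⟨K₀, hK₀⟩ := exists_pow_nsmul_family_eq_zero (hS'fin.insert 𝔭) τ
  -- (4) Poitou–Tate surgery
  obtain ⟨N, xN, hxN, hloc⟩ := levelLiftingP_of_finite_anyTorsion W p 𝔭 S' T hPT
    (fun w ↦ IsTotallyComplex.isComplex w) h𝔭 h𝔮 hne hSp hinf hpT hSig hbad hfinR htor𝔮 K₀ τ hK₀
  set g : galoisCohomology (primaryGaloisModule W p) 1 :=
    galoisCohomology.map (Levels.primaryInclusion W p N) 1 xN with hg
  -- (5) the corrected class
  set y : W.subgroupH1 p κ.kerSubgroup :=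
    y₀ - ResKernel.resSubgroup κ.kerSubgroup (W.geomPrimaryTorsion p) (toDiscreteH1 hM g) with hy
  have hconj : ∀ σ : absoluteGaloisGroup K, W.conjH1 p κ.kerSubgroup σ y =
      y + (W.conjH1 p κ.kerSubgroup σ y₀ - y₀) := by
    intro σ
    rw [hy, map_sub, conjH1_resSubgroup]
    abel
  -- the local computation of `y`
  have hresy : ∀ (v : HeightOneSpectrum (𝓞 K)), resKerD κ (W.geomPrimaryTorsion p) v y =
      resKerD κ (W.geomPrimaryTorsion p) v y₀ -
        ResKernel.resSubgroup (kerD κ v) (W.geomPrimaryTorsion p)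
          (ResKernel.resSubgroup (decomp v) (W.geomPrimaryTorsion p) (toDiscreteH1 hM g)) := by
    intro v
    rw [hy, map_sub, resKerD_resSubgroup]
  have haway : ∀ (v : HeightOneSpectrum (𝓞 K)), (((p : ℕ) : 𝓞 K) ∉ v.asIdeal ∨ v = 𝔭) →
      y ∈ awayKer κ.kerSubgroup (W.geomPrimaryTorsion p) v := by
    intro v hv
    rw [mem_awayKer_iff_resKerD_eq_zero, hresy]
    by_cases hvI : v ∈ insert 𝔭 S'
    · -- prescribed place: `loc_v g = infl Ψ_v`
      have hl := hloc ⟨v, hvI⟩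
      have e : ResKernel.resSubgroup (decomp v) (W.geomPrimaryTorsion p) (toDiscreteH1 hM g) =
          z v (hmem ⟨v, hvI⟩) :=
        resSubgroup_decomp_eq_of_localization_eq hM v g _ hl
      rw [e, hz, sub_self]
    · -- other place away from `p`: `loc_v g = 0` and `y₀` locally trivial
      have hpv : ((p : ℕ) : 𝓞 K) ∉ v.asIdeal := by
        rcases hv with h | rfl
        · exact h
        · exact (hvI (Set.mem_insert _ _)).elim
      have hvS : v ∉ S' := fun h ↦ hvI (Set.mem_insert_of_mem _ h)
      have h0 : galoisCohomology.localization (primaryGaloisModule W p) (Sum.inr v) 1 g = 0 :=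
        localization_map_primaryInclusion_eq_zero_of_mem_upperStructureP W p N 𝔭 S' hxN h𝔭 hpv hvS
      rw [resSubgroup_decomp_eq_zero_of_localization_eq_zero hM v g h0, map_zero, sub_zero]
      exact hzero v hpv hvS
  have hySel : y ∈ selmerAc W p κ 𝔭 ∅ := by
    change y ∈ selmerOver κ.kerSubgroup (W.geomPrimaryTorsion p) p 𝔭 ∅
    rw [mem_selmerOver_iff_awayKer]
    refine ⟨fun v hpv _ σ ↦ ?_, fun w σ ↦ ?_, fun σ ↦ ?_⟩
    · rw [hconj]
      exact add_mem (haway v (Or.inl hpv)) ((mem_awayKer_iff_resKerD_eq_zero κ v _).2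
        (resKerD_eq_zero_of_mem_selmerAc (Or.inl ⟨hpv, Set.notMem_empty v⟩) (hSel σ)))
    · exact mem_infKer_of_decompInf_eq_bot w
        (decompInf_eq_bot_of_isComplex (IsTotallyComplex.isComplex w)) _
    · rw [hconj]
      exact add_mem (haway 𝔭 (Or.inr rfl)) ((mem_awayKer_iff_resKerD_eq_zero κ 𝔭 _).2
        (resKerD_eq_zero_of_mem_selmerAc (Or.inr rfl) (hSel σ)))
  refine ⟨⟨y, hySel⟩, Subtype.ext ?_⟩
  change W.conjH1 p κ.kerSubgroup γ y - y = (x : W.subgroupH1 p κ.kerSubgroup)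
  rw [hconj, hy₀]
  abel

end Coinvariants

/-! ## §2. (L10) for `E/ℚ` over an imaginary quadratic `K` at EVERY frame, and the registered stub
`stub_coinv` modulo the cited Poitou–Tate facts and the crux's Kolyvagin antecedent -/

section Crux

variable (W : WeierstrassCurve ℚ) [W.IsElliptic] [W.IsGloballyMinimal] (p : ℕ) [Fact p.Prime]
  {K : Type} [Field K] [NumberField K]

/-- **(L10) `CoinvariantsTrivialAt (E_K) p κ 𝔭 γ` at EVERY frame (any `g`, any `t`)** for `E/ℚ`, `K`
imaginary quadratic with `p` split, a degree-one `𝔭 ∋ p`, GIVEN the cited Poitou–Tate facts for `K`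
(duality for Selmer structures; duality for `Ш`) and the finiteness of Castella's `Sel_v(K, E[p^∞])` at
both `v ∣ p`. `cd_p K ≤ 2` and Milne I 2.8 are tree theorems (`fieldCdLE_two_of_numberField_holds`,
`localEulerPoincareCharacteristic_adicCompletionEP`); the killing exponents come from the finiteness of
`E(K_v)[p^∞]` (`exists_pow_nsmul_local_eq_zero`, `exists_pow_nsmul_fixedPoints_decomp_eq_zero`).
[cite: JetchevSkinnerWan2017, Lemma 3.3.3 (arXiv:1512.06894 pp. 11–12)]
[cite: MilneADT2006, Ch. I, Thm. 4.10] [cite: Harari2020, Thm. 17.13 (b)] -/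
theorem coinvariantsTrivialAt_of_finite_anyTorsion (hK : IsImaginaryQuadratic K) (hsplit : SplitsIn K p)
    (hPT : poitouTate_selmerStructure_duality K) (hPT2 : poitouTate_sha_tateDual K)
    (κ : ZpExtension K p) {γ : absoluteGaloisGroup K} (hγ : κ.IsTopGenerator γ)
    {𝔭 : HeightOneSpectrum (𝓞 K)} (h𝔭 : ((p : ℕ) : 𝓞 K) ∈ 𝔭.asIdeal)
    (hfin : ∀ v : HeightOneSpectrum (𝓞 K), ((p : ℕ) : 𝓞 K) ∈ v.asIdeal →
      Finite (selmerAcBase (W.baseChange K) p v ∅)) :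
    CoinvariantsTrivialAt (W.baseChange K) p κ 𝔭 γ := by
  haveI : IsTotallyComplex K := hK.2
  haveI hEK : (W.baseChange K).IsElliptic := by rw [WeierstrassCurve.baseChange]; infer_instance
  obtain ⟨σ, 𝔮, -, hne, h𝔮, -⟩ :=
    LocalIndexTransport.exists_conj_prime_of_splitsIn K p hK.1 hsplit h𝔭
  have htor := exists_pow_nsmul_local_eq_zero W p hK.1 hsplit
  haveI := hfin 𝔭 h𝔭
  have h2 := subsingleton_galoisCohomology_two_primary_anyTorsion (W.baseChange K) p 𝔭 ∅ hPT2
    (fieldCdLE_two_of_isTotallyComplex fieldCdLE_two_of_numberField_holds K p) htor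
  obtain ⟨he𝔮, hf𝔮⟩ := degreeOne_of_splitsIn hK.1 hsplit h𝔮
  obtain ⟨m, hm⟩ := exists_pow_nsmul_fixedPoints_decomp_eq_zero W p 𝔮 h𝔮 he𝔮 hf𝔮
  exact coinvariantsTrivialAt_of_subsingleton_anyTorsion (W.baseChange K) p κ hPT h𝔭 h𝔮 hne hm
    (hfin 𝔮 h𝔮) h2 hγ

open Literature.NumberTheory.EllipticCurves.ModularForms
  Literature.NumberTheory.EllipticCurves.Rank1Residual
  Literature.NumberTheory.EllipticCurves.Rank1Residual.Typed
  Summit.BirchSwinnertonDyer.Rank1Residual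
  Summit.BirchSwinnertonDyer.BirchSwinnertonDyer.Theorems.SchneiderFree
  Summit.BirchSwinnertonDyer.BirchSwinnertonDyer.Theorems.SchneiderFreeControlAtoms in
/-- **The registered stub `stub_coinv` (skeleton v3-K of crux `AnticycControlAdditiveK`, signature
VERBATIM as the conclusion) ⇐ the cited Poitou–Tate duality for Selmer structures and for `Ш` (every
number field) + the crux's own Kolyvagin antecedent — NOTHING ELSE**, at every frame (regime B2
`E(K)[p] ≠ 0` and `t_p ≥ 1` included): finiteness of `Sel_v(K, E[p^∞])` at both `v ∣ p` from
`finite_selmerAcBase_of_rankOne_anyTorsion` (rank one and `Ш` finite from Kolyvagin), then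
`coinvariantsTrivialAt_of_finite_anyTorsion`. A CONDITIONAL discharge: like `stub_ptSurj`, the stub's
own signature carries no Kolyvagin prefix although JSW17 Lemma 3.3.3 consumes (corank 1) + (sur).
[cite: JetchevSkinnerWan2017, Lemma 3.3.3 (arXiv:1512.06894 pp. 11–12)] [cite: Gross1991, Thm. 1.3]
[cite: MilneADT2006, Ch. I, Thm. 4.10] [cite: Harari2020, Thm. 17.13 (b)] -/
theorem stub_coinv_of_poitouTate
    (hPT : ∀ (K : Type) [Field K] [NumberField K], poitouTate_selmerStructure_duality K)
    (hPT2 : ∀ (K : Type) [Field K] [NumberField K], poitouTate_sha_tateDual K)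
    (hKo : ∀ (N : ℕ) [NeZero N] (W : WeierstrassCurve ℚ) (K : Type) [Field K] [NumberField K],
      Literature.NumberTheory.EllipticCurves.kolyvagin N W K) :
    ∀ (W : WeierstrassCurve ℚ) [W.IsElliptic] [W.IsGloballyMinimal] (p : ℕ) [Fact p.Prime],
      W.analyticRank = 1 → p ≠ 2 → ClassX3 W p → Additive.SubSemistableTwist W p →
      ∀ (N : ℕ) [NeZero N] (K : Type) [Field K] [NumberField K]
        (Dt : ModularParametrizationData W N) (H : HeegnerDatum N (NumberField.discr K)) (ι : K →+* ℂ)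
        (P : (W.baseChange K).toAffine.Point),
        W.analyticRank = 1 → Additive.N10.Locus W p → W.conductorNorm ℤ = N →
        ∀ hK : IsImaginaryQuadratic K,
        Odd (NumberField.discr K) → ¬ p ∣ Units.torsionOrder K → SatisfiesHeegnerHypothesis N K →
        (W.quadraticTwist (NumberField.discr K : ℚ)).entireLFunction 1 ≠ 0 →
        WeierstrassCurve.Affine.Point.map ι.toRatAlgHom P = heegnerPointComplex Dt H →
        ¬ IsOfFinAddOrder P →
        ∀ (κ : ZpExtension K p), κ.IsAnticyclotomic →
          ∀ (γ : Field.absoluteGaloisGroup K) [Fact (κ.IsTopGenerator γ)]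
            (𝔭 : HeightOneSpectrum (𝓞 K)) (h𝔭 : ((p : ℕ) : 𝓞 K) ∈ 𝔭.asIdeal)
            (he : 𝔭.asIdeal.ramificationIdx (𝓞 ℚ) = 1) (hf : 𝔭.asIdeal.inertiaDeg (𝓞 ℚ) = 1),
            X11b.CoinvariantsTrivialAt (W.baseChange K) p κ 𝔭 γ := by
  intro W _ _ p _ _ _ _ _ N _ K _ _ Dt H ι P _ hloc hN hK _ _ hHe _ hP hnt κ _ γ hγ 𝔭 h𝔭 _ _
  have hpN : p ∣ W.conductorNorm ℤ := dvd_conductorNorm_of_n10Locus hloc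
  have hsplit : SplitsIn K p := splitsIn_of_satisfiesHeegnerHypothesis hN hHe hpN
  obtain ⟨hrank, hSha⟩ := hKo N W K hK hHe ⟨Dt, H, ι, hP⟩ hnt
  have hfin : ∀ v : HeightOneSpectrum (𝓞 K), ((p : ℕ) : 𝓞 K) ∈ v.asIdeal →
      Finite (selmerAcBase (W.baseChange K) p v ∅) := fun v hv ↦ by
    obtain ⟨hev, hfv⟩ := degreeOne_of_splitsIn hK.1 hsplit hv
    exact finite_selmerAcBase_of_rankOne_anyTorsion W p K
      (poitouTate_sum_localTatePairing_eq_zero_of_selmerStructure_duality (hPT K)) hK hsplit hrank hSha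
      v hv hev hfv
  exact coinvariantsTrivialAt_of_finite_anyTorsion W p hK hsplit (hPT K) (hPT2 K) κ hγ.out h𝔭 hfin

end Crux

end Summit.BirchSwinnertonDyer.BirchSwinnertonDyer.Theorems.SchneiderFreeAdditiveX3

end
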